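import Summits.ResolutionOfSingularities.ResolutionOfSingularities.Theorems.FrobeniusLadderFInjectiveMacaulayficationRMonoidLoop
import Summits.ResolutionOfSingularities.ResolutionOfSingularities.Theorems.FrobeniusLadderFInjectiveMacaulayficationRMonoidNodeChartsFull
import Summits.ResolutionOfSingularities.ResolutionOfSingularities.Theorems.FrobeniusLadderFInjectiveMacaulayficationRMonoidRegularChart
import Literature.AlgebraicGeometry.Resolution.AffineBlowupRegular
import HarnessLib

/-!
# (T-I3b) THE FLOOR OF T″-INSTANCE #6 IS FULL AT EVERY CLOSED POINT — MODULO «`U_R` FULL AT CLOSED POINTS» (T-TOR, HYPOTHESIS-FORM) ALONE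
# (crux `FInjectiveMacaulayfication` stmt-ResolutionOfSingularities-15315, chain w45a, door v41.1; res-L1-w45a-plan-1 RULING R23.7 (B-L)(i) «#6 non-vacuous modulo T-TOR alone»;
# seat res-L1-w45a-lead-1 g12)

[OURS · L1 W4.5a] Support file (`--supports stmt-ResolutionOfSingularities-15315 --as helper`); replaces the role of NO printed item; NOT a statement of any manuscript;
def-free; no named fact; the T-TOR input enters as an explicit HYPOTHESIS `hR` (never claimed). AI-written (AI review is weaker than expert review). Nothing of the crux proved.

★ `fullCl_stalk_floor_of_closed` — `X₁ = Bl_J U_R` (`RMonoidDefs.rDatum / rJ`, `J = I(Sing_red U_R)`, `k` of characteristic `p`): IF every closed point of `U_R = Spec k[R]`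
has a FULL stalk (`hR`; on paper Hochster's theorem «normal affine semigroup rings are CM and F-pure» = the RESERVED print T-TOR), THEN every CLOSED point `y ∈ X₁` has
`FullCl p 𝒪_{X₁,y}`. PROOF = the seven Rees charts cover `X₁` (`affineBlowup.iSup_basicOpen_reesT_generators_eq_top`) and, chart by chart: `l ∈ {0,2,4}` — ★ LOOP LEMMA
✓`RMonoidLoop.exists_isOpenImmersion_reesChart_rDatum` (the chart is an open piece `≅ U_R`; `hR` transported along the stalk isomorphism); `l = 1` —
✓`RMonoidRegularChart.fullCl_stalk_chart_one` (regular, FULL at every point); `l ∈ {3,5,6}` — ✓`RMonoidNodeChartsFull.fullCl_stalk_nodeChart` (`𝔸¹ × node`, Fedder).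
So the FULL-input caveat of instance #6 (`RMonoidTStep.tStepInstanceAt_recurrentMonoid_rDatum`) is reduced, at closed points of the floor, to T-TOR for the bed itself.
Not treated: non-closed points; the germ-level base change `S′ = X₁ ×_{U_R} Spec 𝒪_{U_R,x}` of the instance's quantifier.
[OURS · assembly; cite: Hochster1972 (context, NOT used: hypothesis-form); StacksProject, Tag 0804]
-/

-- single-problem summit: the doubled namespace component is forced
set_option linter.dupNamespace false

noncomputable section

namespace Summit.ResolutionOfSingularities.ResolutionOfSingularities.Theorems.FInjectiveMacaulayfication.RMonoidFloorFull

open CategoryTheory AlgebraicGeometry TopologicalSpace Literature.AlgebraicGeometry.Resolution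
open Summit.ResolutionOfSingularities.ResolutionOfSingularities.Theorems.FInjectiveMacaulayfication
open Summit.ResolutionOfSingularities.ResolutionOfSingularities.Theorems.WildQuotientResolution
open Summit.ResolutionOfSingularities.ResolutionOfSingularities.Theorems.WildQuotientResolution.ToricChart

/-- Closed points pull back to closed points along an open immersion (injective continuous map). [plumbing] -/
theorem isClosed_singleton_of_isOpenImmersion {X Y : Scheme.{0}} (f : X ⟶ Y) [IsOpenImmersion f] (x : X) (h : IsClosed ({f.base x} : Set Y)) :
    IsClosed ({x} : Set X) := by
  have hpre : f.base ⁻¹' {f.base x} = {x} :=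
    Set.ext fun z => ⟨fun hz => f.isOpenEmbedding.injective hz, fun hz => by rw [Set.mem_singleton_iff.mp hz]; rfl⟩
  rw [← hpre]
  exact h.preimage f.base.hom.continuous

/-- ★ **The floor `X₁ = Bl_{Sing_red} U_R` of T″-instance #6 is FULL at every CLOSED point, modulo «`U_R` FULL at closed points» (T-TOR, hypothesis `hR`) alone.** [OURS · assembly] -/
theorem fullCl_stalk_floor_of_closed (p : ℕ) [Fact p.Prime] (k : Type) [Field k] [CharP k p]
    (hR : ∀ q : Spec (.of (Ring k PEmpty RMonoidDefs.rDatum)), IsClosed ({q} : Set (Spec (.of (Ring k PEmpty RMonoidDefs.rDatum)))) →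
      SliceableCentre.FullCl p ((Spec (.of (Ring k PEmpty RMonoidDefs.rDatum))).presheaf.stalk q))
    (y : ↥(affineBlowup (Ideal.span (Set.range fun l : Fin 7 => wordElem k PEmpty RMonoidDefs.rDatum (RMonoidDefs.rJ l)))))
    (hyc : IsClosed ({y} : Set ↥(affineBlowup (Ideal.span (Set.range fun l : Fin 7 => wordElem k PEmpty RMonoidDefs.rDatum (RMonoidDefs.rJ l)))))) :
    SliceableCentre.FullCl p ((affineBlowup (Ideal.span (Set.range fun l : Fin 7 => wordElem k PEmpty RMonoidDefs.rDatum (RMonoidDefs.rJ l)))).presheaf.stalk y) := by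
  -- the seven generator charts cover `X₁`
  have hcov := affineBlowup.iSup_basicOpen_reesT_generators_eq_top (fun l : Fin 7 => wordElem k PEmpty RMonoidDefs.rDatum (RMonoidDefs.rJ l))
  have hy : y ∈ (⨆ l : Fin 7, Proj.basicOpen (reesGrading (Ideal.span (Set.range fun l : Fin 7 => wordElem k PEmpty RMonoidDefs.rDatum (RMonoidDefs.rJ l))))
      (reesT (wordElem k PEmpty RMonoidDefs.rDatum (RMonoidDefs.rJ l))
        (Ideal.mem_span_range_self (f := fun l : Fin 7 => wordElem k PEmpty RMonoidDefs.rDatum (RMonoidDefs.rJ l)) (x := l)))) := by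
    rw [hcov]; trivial
  obtain ⟨l, hl⟩ := Opens.mem_iSup.mp hy
  -- the `≅ U_R` charts: transport `hR`
  have loop : ∀ j₀ : Fin 7, j₀ = 0 ∨ j₀ = 2 ∨ j₀ = 4 →
      y ∈ Proj.basicOpen (reesGrading (Ideal.span (Set.range fun l : Fin 7 => wordElem k PEmpty RMonoidDefs.rDatum (RMonoidDefs.rJ l))))
        (reesT (wordElem k PEmpty RMonoidDefs.rDatum (RMonoidDefs.rJ j₀))
          (Ideal.mem_span_range_self (f := fun l : Fin 7 => wordElem k PEmpty RMonoidDefs.rDatum (RMonoidDefs.rJ l)) (x := j₀))) →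
      SliceableCentre.FullCl p ((affineBlowup (Ideal.span (Set.range fun l : Fin 7 =>
        wordElem k PEmpty RMonoidDefs.rDatum (RMonoidDefs.rJ l)))).presheaf.stalk y) := by
    intro j₀ hj₀ hyj
    obtain ⟨ι, hι, hrange⟩ := RMonoidLoop.exists_isOpenImmersion_reesChart_rDatum k PEmpty j₀ hj₀
    have hy' : y ∈ (ι.opensRange : Set _) := by rw [hrange]; exact hyj
    obtain ⟨q, rfl⟩ := hy'
    exact RMonoidNodeChartsFull.fullCl_stalk_of_isOpenImmersion p ι q (hR q (isClosed_singleton_of_isOpenImmersion ι q hyc))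
  fin_cases l
  · exact loop 0 (Or.inl rfl) hl
  · exact RMonoidRegularChart.fullCl_stalk_chart_one p k y hl
  · exact loop 2 (Or.inr (Or.inl rfl)) hl
  · exact RMonoidNodeChartsFull.fullCl_stalk_nodeChart p k 3 (Or.inl rfl) y hl hyc
  · exact loop 4 (Or.inr (Or.inr rfl)) hl
  · exact RMonoidNodeChartsFull.fullCl_stalk_nodeChart p k 5 (Or.inr (Or.inl rfl)) y hl hyc
  · exact RMonoidNodeChartsFull.fullCl_stalk_nodeChart p k 6 (Or.inr (Or.inr rfl)) y hl hyc

end Summit.ResolutionOfSingularities.ResolutionOfSingularities.Theorems.FInjectiveMacaulayfication.RMonoidFloorFull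

end
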